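import Summits.AtomisticToContinuum.Crystallization.Theorems.ChargedEnergyGapCoherenceDial

/-!
# `PricedLinkCensus.ChargedEnergyGap` (stmt-AtomisticToContinuum-14231) — the COHERENCE dial, part H-B: coherent / incoherent core pricing,
# the maximal one-way debit, the record cone (decomp-a2c lens 3, generation 46; RE-ISSUED generation 47 over the re-pointed part H-A —
# only the two `δ ≥ 5/8` end lemmas of §1 change name and literal, critic row 901 (a′)(β); over part H-A `ChargedEnergyGapCoherenceDial`)

The G-side line of record is `[G] GrossChargeGap (3/20) ⟺ IP ∧ IDP(40) ∧ FCP(40)` (part G): the engine target IDP prices the INTERFACIAL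
deep-rigid cores — compact gross charged motif sites, `(10, 1/100)`-rigid in every presentation, with a charge-free particle within
reach `40` — by «incompatibility pricing over the chart frames within reach».  That engine (Read–Shockley, Lauteri–Luckhaus, geometric
rigidity) prices exactly ONE thing: a HOLONOMY — the impossibility of continuing one rigid crystal frame around the defect.  Part H-A typed
that datum (`CoherentWithin δ L' Q p`, `exists_charted_misfit`) and cut the interfacial species by it; this file prices the two halves.

§1 Pieces CCP `CoherentCorePricing`, NCP `IncoherentCorePricing`; ★ `ICP ⟺ CCP ∧ NCP`, ★ `DRP ⟺ FCP ∧ CCP ∧ NCP` (exact).  THE MAXIMAL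
   ONE-WAY DEBIT NGP `IncoherentGrossDebitPricing`: incoherent cores priced up to a debit `C` per OTHER gross charged motif site (exposed,
   improvable, shallow-rigid, frustrated, coherent — every place an elastic certificate over «crystal + its incompatibilities» can leak);
   ★★ `incoherentCorePricing_of_grossDebit : EGP → IP → FCP → CCP → NGP → NCP` (constant `κ/(1 + C Σ 1/κᵢ)`; uses SRP ⟸ IP of part F-B and
   the six-species census `motifChargedGross_eq_six_species`).  A debit onto the P-side species would close only under `κ_P κ_G > C_P C_G`
   (part G, dead end); this is the largest debit that closes unconditionally.  Dials and the two ends of part H-A on the pieces.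
§2 ★★ `grossChargeGap_iff_coherence_record : [G] ⟺ IP ∧ FCP(40) ∧ CCP(40 | 1/10, 40) ∧ NGP(40 | 1/10, 40)` — the whole gross side at the
   record `(θ, ε, R, r, η, L, δ, L') = (3/20, 1/10, 6/5, 10, 1/100, 40, 1/10, 40)`; cones by name; WEAKER certificates from the crux.

TAGS (pieces at the record).
NCP `IncoherentCorePricing` / NGP `IncoherentGrossDebitPricing` · WEAKER than ICP / IDP-type (proved: sub-species; NGP ⟸ NCP with `C = 0`) ·
  ★ THE ENGINE TARGET: every inhabitant of the known interfacial zoo is INCOHERENT at `(1/10, 40)` (dislocations and their dipoles / loops /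
  locks, stacking-fault tetrahedra, low- and high-angle grain boundaries, incoherent twins, prismatic faults — deficit table in the MEMO) ·
  IDEA-NEEDED «of a known kind»: geometric rigidity (Friesecke–James–Müller, CPAM 2002) + the incompatibility lower bound (Read–Shockley;
  Lauteri–Luckhaus arXiv:1608.06155; Garroni–Leoni–Ponsiglione, JEMS 2010) + localisation with debits onto the five other species — the typed
  datum `exists_charted_misfit` is precisely that engine's input · why it might fail: a core whose only misfit is far-field elastic drift
  `> δ` sourced OUTSIDE the `L'`-ball (priced by nobody inside it) — answered by the debit `C` onto the sources if they are charged, open if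
  the source is a coherent precipitate (none monatomic).
CCP `CoherentCorePricing` · WEAKER than ICP (proved) · ★ DECLARED SUB-RESIDUAL #2 of the G-side (after FCP): deep-rigid cores whose charge-free
  surroundings within `40` fit ONE rigid Barlow frame to `1/10` — zero holonomy, zero rigid shift, zero tilt · CONJECTURALLY VACUOUS for
  monatomic Lennard-Jones: an inhabitant is a mechanically stable, `(10, 1/100)`-deep-rigid, non-Barlow inclusion or layer COHERENTLY embedded
  in crystal (any rigid-body shift `t ∉ Λ` or tilt makes it incoherent; vacancy-type layers are exposed; interstitial-type layers are extra
  planes, i.e. crystal; amorphous / icosahedral pockets inside a coherent frame recrystallise under a `10`-local surgery) · INSTRUMENTABLE —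
  census ask L3-COH · BARRIER position: outside `TetrahedralFrustration` (crystal within reach, frame coherent) and outside the sharp
  LocalCertificateBarrier only conjecturally (an icosahedral pocket is improvable, hence not in the species) · this IS the «thin-slab caveat» of
  part G (critic row 894), now isolated: a slab or inclusion with a rigid-body shift `∉ Λ` or a tilt against the surrounding crystal is
  INCOHERENT and belongs to the engine target; only the shift-free, tilt-free, fit-to-`1/10` ones remain here.
FCP(40) unchanged (part G: sub-residual #1, conjecturally vacuous, L3-NUC / L3-REACH).
WHY NOVEL.  First HOLONOMY-sorted species on the 14231 G-side: the sorting datum is not a label map with drift bounds on a far field (the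
lens-4 labellings, a hypothesis there) and not a limit object (lens 5), but the non-existence of a single rigid Barlow image through the
charge-free points within reach — stated without labels, with free stacking sequence, as an exact species split of the residual of
record, together with the largest debit structure that provably closes.  WHY EACH PIECE IS STRICTLY WEAKER: CCP / NCP price sub-species of
the ICP species (count split); NGP is NCP with a debit.  All `[this work]`; Barlow point sets and their covering radius from
`Literature.MathematicalPhysics.StatisticalMechanics.{BarlowStacking, BarlowCovering}` (Conway–Sloane Ch. 1 §1.3, Ch. 4 §6).
-/

noncomputable section

open scoped Classical
open Literature.MathematicalPhysics.StatisticalMechanics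
open Literature.Geometry.DiscreteGeometry
open Summit.AtomisticToContinuum.Crystallization.Theses.PricedLinkCensus
open Summit.AtomisticToContinuum.Crystallization.Theorems.ChargedEnergyGapNegative

namespace Summit.AtomisticToContinuum.Crystallization.Theorems.ChargedEnergyGapChartDial

/-! ## §1 The pieces: coherent / incoherent core pricing, the maximal one-way debit, exactness -/

/-- piece CCP · WEAKER than ICP (proved `coherentCorePricing_of_interfacialCorePricing`) · DECLARED SUB-RESIDUAL #2 · CONJECTURALLY VACUOUS
(coherently embedded deep-rigid non-Barlow inclusions; none monatomic) · INSTRUMENTABLE (census L3-COH).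
**Coherent core pricing**: `κ` per coherent interfacial core. -/
def CoherentCorePricing (θ ε R r η L δ L' : ℝ) : Prop :=
  ∃ κ : ℝ, 0 < κ ∧ ∀ Q : PeriodicConfiguration 3, κ * (motifCoreCoherent θ ε R r η L δ L' Q : ℝ) ≤ excess Q

/-- piece NCP · WEAKER than ICP (proved `incoherentCorePricing_of_interfacialCorePricing`) · THE ENGINE TARGET (every known interfacial
inhabitant is incoherent at the record) · IDEA-NEEDED of a known kind (rigidity + incompatibility lower bound + localisation).
**Incoherent core pricing**: `κ` per incoherent interfacial core. -/
def IncoherentCorePricing (θ ε R r η L δ L' : ℝ) : Prop :=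
  ∃ κ : ℝ, 0 < κ ∧ ∀ Q : PeriodicConfiguration 3, κ * (motifCoreIncoherent θ ε R r η L δ L' Q : ℝ) ≤ excess Q

/-- piece NGP · WEAKER than NCP (proved, `C = 0`) · ENGINE-SHAPED, MAXIMAL DEBIT: the certificate may leak `C` per gross charged motif site
of ANY OTHER species · closes against the debit-free pieces (`incoherentCorePricing_of_grossDebit`).
**Incoherent gross-debit pricing**: `κ` per incoherent core, up to the excess plus `C` per other gross charged motif site. -/
def IncoherentGrossDebitPricing (θ ε R r η L δ L' : ℝ) : Prop :=
  ∃ κ C : ℝ, 0 < κ ∧ 0 ≤ C ∧ ∀ Q : PeriodicConfiguration 3,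
    κ * (motifCoreIncoherent θ ε R r η L δ L' Q : ℝ) ≤
      excess Q + C * ((motifChargedGross θ Q : ℝ) - (motifCoreIncoherent θ ε R r η L δ L' Q : ℝ))

/-- `CoherentCorePricing` is the species pricing of the coherent-core count (definitional). -/
theorem coherentCorePricing_iff_speciesPricing (θ ε R r η L δ L' : ℝ) :
    CoherentCorePricing θ ε R r η L δ L' ↔ SpeciesPricing (motifCoreCoherent θ ε R r η L δ L') := Iff.rfl

/-- `IncoherentCorePricing` is the species pricing of the incoherent-core count (definitional). -/
theorem incoherentCorePricing_iff_speciesPricing (θ ε R r η L δ L' : ℝ) :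
    IncoherentCorePricing θ ε R r η L δ L' ↔ SpeciesPricing (motifCoreIncoherent θ ε R r η L δ L') := Iff.rfl

/-- ★ **THE COHERENCE SPLIT IS EXACT**: `ICP L ⟺ CCP ∧ NCP`, every `θ ε R r η L δ L'`. -/
theorem interfacialCorePricing_iff_coherent_incoherent (θ ε R r η L δ L' : ℝ) :
    InterfacialCorePricing θ ε R r η L ↔ CoherentCorePricing θ ε R r η L δ L' ∧ IncoherentCorePricing θ ε R r η L δ L' := by
  rw [interfacialCorePricing_iff_speciesPricing,
    speciesPricing_congr (c' := fun Q => motifCoreCoherent θ ε R r η L δ L' Q + motifCoreIncoherent θ ε R r η L δ L' Q)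
      (fun Q => by rw [motifCoreInterfacial_eq_incoherent_add_coherent θ ε R r η L δ L' Q, add_comm]),
    speciesPricing_add_iff]
  exact Iff.rfl

/-- Interfacial core pricing prices the coherent cores (a sub-species). -/
theorem coherentCorePricing_of_interfacialCorePricing {θ ε R r η L : ℝ} (δ L' : ℝ) (h : InterfacialCorePricing θ ε R r η L) :
    CoherentCorePricing θ ε R r η L δ L' :=
  ((interfacialCorePricing_iff_coherent_incoherent θ ε R r η L δ L').1 h).1

/-- Interfacial core pricing prices the incoherent cores (a sub-species). -/
theorem incoherentCorePricing_of_interfacialCorePricing {θ ε R r η L : ℝ} (δ L' : ℝ) (h : InterfacialCorePricing θ ε R r η L) :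
    IncoherentCorePricing θ ε R r η L δ L' :=
  ((interfacialCorePricing_iff_coherent_incoherent θ ε R r η L δ L').1 h).2

/-- ★ **THE RESIDUAL IN THREE DEBIT-FREE PIECES**: `DRP ⟺ FCP ∧ CCP ∧ NCP`, every `θ ε R r η L δ L'`. -/
theorem deepRigidPricing_iff_frustrated_coherent_incoherent (θ ε R r η L δ L' : ℝ) :
    DeepRigidPricing θ ε R r η ↔ FrustratedCorePricing θ ε R r η L ∧ CoherentCorePricing θ ε R r η L δ L' ∧
      IncoherentCorePricing θ ε R r η L δ L' := by
  rw [deepRigidPricing_iff_frustrated_interfacial θ ε R r η L, interfacialCorePricing_iff_coherent_incoherent θ ε R r η L δ L']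

/-- NGP is weaker than NCP (no debit needed). -/
theorem incoherentGrossDebitPricing_of_incoherentCorePricing {θ ε R r η L δ L' : ℝ} (h : IncoherentCorePricing θ ε R r η L δ L') :
    IncoherentGrossDebitPricing θ ε R r η L δ L' := by
  obtain ⟨κ, hκ, h⟩ := h
  exact ⟨κ, 0, hκ, le_rfl, fun Q => by rw [zero_mul, add_zero]; exact h Q⟩

/-- ★★ **THE MAXIMAL ONE-WAY DEBIT CLOSES**: incoherent cores priced up to a debit per other gross charged site, together with the
debit-free pricings of the five other species (exposed EGP; improvable IP, which also gives the shallow-rigid SRP, part F-B; frustrated FCP;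
coherent CCP), price the incoherent cores debit-free — constant `κ / (1 + C Σᵢ 1/κᵢ)`. -/
theorem incoherentCorePricing_of_grossDebit {θ ε R r η L δ L' : ℝ} (hE : ExposedGrossPricing θ ε R) (hI : ImprovablePricing θ ε R r η)
    (hF : FrustratedCorePricing θ ε R r η L) (hC : CoherentCorePricing θ ε R r η L δ L') (hN : IncoherentGrossDebitPricing θ ε R r η L δ L') :
    IncoherentCorePricing θ ε R r η L δ L' := by
  have hS : ShallowRigidPricing θ ε R r η := shallowRigidPricing_of_improvablePricing hI
  obtain ⟨κ₁, hκ₁, h₁⟩ := hE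
  obtain ⟨κ₂, hκ₂, h₂⟩ := hI
  obtain ⟨κ₃, hκ₃, h₃⟩ := hS
  obtain ⟨κ₄, hκ₄, h₄⟩ := hF
  obtain ⟨κ₅, hκ₅, h₅⟩ := hC
  obtain ⟨κ, C, hκ, hC0, hN⟩ := hN
  obtain ⟨M, hM⟩ : ∃ M : ℝ, M = 1 / κ₁ + 1 / κ₂ + 1 / κ₃ + 1 / κ₄ + 1 / κ₅ := ⟨_, rfl⟩
  have hM0 : 0 ≤ M := by rw [hM]; positivity
  have hden : 0 < 1 + C * M := by positivity
  refine ⟨κ / (1 + C * M), by positivity, fun Q => ?_⟩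
  have hsum : (motifChargedGross θ Q : ℝ) - (motifCoreIncoherent θ ε R r η L δ L' Q : ℝ) =
      motifGrossExposed θ ε R Q + motifCompactImprovable θ ε R r η Q + motifCompactShallow θ ε R r η Q +
        motifCoreFrustrated θ ε R r η L Q + motifCoreCoherent θ ε R r η L δ L' Q := by
    rw [motifChargedGross_eq_six_species θ ε R r η L δ L' Q]; push_cast; ring
  have b₁ : (motifGrossExposed θ ε R Q : ℝ) ≤ excess Q / κ₁ := by rw [le_div_iff₀ hκ₁]; linarith [h₁ Q]
  have b₂ : (motifCompactImprovable θ ε R r η Q : ℝ) ≤ excess Q / κ₂ := by rw [le_div_iff₀ hκ₂]; linarith [h₂ Q]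
  have b₃ : (motifCompactShallow θ ε R r η Q : ℝ) ≤ excess Q / κ₃ := by rw [le_div_iff₀ hκ₃]; linarith [h₃ Q]
  have b₄ : (motifCoreFrustrated θ ε R r η L Q : ℝ) ≤ excess Q / κ₄ := by rw [le_div_iff₀ hκ₄]; linarith [h₄ Q]
  have b₅ : (motifCoreCoherent θ ε R r η L δ L' Q : ℝ) ≤ excess Q / κ₅ := by rw [le_div_iff₀ hκ₅]; linarith [h₅ Q]
  have hD : (motifChargedGross θ Q : ℝ) - (motifCoreIncoherent θ ε R r η L δ L' Q : ℝ) ≤ M * excess Q := by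
    have hx : M * excess Q = excess Q / κ₁ + excess Q / κ₂ + excess Q / κ₃ + excess Q / κ₄ + excess Q / κ₅ := by rw [hM]; ring
    rw [hsum, hx]; linarith [b₁, b₂, b₃, b₄, b₅]
  have hmain : κ * (motifCoreIncoherent θ ε R r η L δ L' Q : ℝ) ≤ excess Q + C * (M * excess Q) := by
    linarith [hN Q, mul_le_mul_of_nonneg_left hD hC0]
  rw [div_mul_eq_mul_div, div_le_iff₀ hden]
  linarith [hmain]

/-- ★ The residual from the engine pieces: `FCP → CCP → NGP → DRP` (given EGP and IP). -/
theorem deepRigidPricing_of_coherenceDial {θ ε R r η L δ L' : ℝ} (hE : ExposedGrossPricing θ ε R) (hI : ImprovablePricing θ ε R r η)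
    (hF : FrustratedCorePricing θ ε R r η L) (hC : CoherentCorePricing θ ε R r η L δ L') (hN : IncoherentGrossDebitPricing θ ε R r η L δ L') :
    DeepRigidPricing θ ε R r η :=
  (deepRigidPricing_iff_frustrated_coherent_incoherent θ ε R r η L δ L').2 ⟨hF, hC, incoherentCorePricing_of_grossDebit hE hI hF hC hN⟩

/-- The dials on CCP: antitone in `δ`, monotone in `L'` (it prices the coherent count). -/
theorem coherentCorePricing_anti {θ ε R r η L δ δ' L' L'' : ℝ} (hδ : δ ≤ δ') (hL : L'' ≤ L')
    (h : CoherentCorePricing θ ε R r η L δ' L'') : CoherentCorePricing θ ε R r η L δ L' :=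
  SpeciesPricing.mono h fun Q => motifCoreCoherent_mono hδ hL Q

/-- The dials on NCP: monotone in `δ`, antitone in `L'`. -/
theorem incoherentCorePricing_mono {θ ε R r η L δ δ' L' L'' : ℝ} (hδ : δ ≤ δ') (hL : L'' ≤ L')
    (h : IncoherentCorePricing θ ε R r η L δ L') : IncoherentCorePricing θ ε R r η L δ' L'' :=
  SpeciesPricing.mono h fun Q => motifCoreIncoherent_anti hδ hL Q

/-- The dials on NGP: monotone in `δ`, antitone in `L'` (fewer sites to price, more to debit). -/
theorem incoherentGrossDebitPricing_mono {θ ε R r η L δ δ' L' L'' : ℝ} (hδ : δ ≤ δ') (hL : L'' ≤ L')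
    (h : IncoherentGrossDebitPricing θ ε R r η L δ L') : IncoherentGrossDebitPricing θ ε R r η L δ' L'' := by
  obtain ⟨κ, C, hκ, hC, h⟩ := h
  refine ⟨κ, C, hκ, hC, fun Q => ?_⟩
  have h1 : (motifCoreIncoherent θ ε R r η L δ' L'' Q : ℝ) ≤ motifCoreIncoherent θ ε R r η L δ L' Q :=
    Nat.cast_le.2 (motifCoreIncoherent_anti hδ hL Q)
  calc κ * (motifCoreIncoherent θ ε R r η L δ' L'' Q : ℝ) ≤ κ * (motifCoreIncoherent θ ε R r η L δ L' Q : ℝ) :=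
        mul_le_mul_of_nonneg_left h1 hκ.le
    _ ≤ excess Q + C * ((motifChargedGross θ Q : ℝ) - (motifCoreIncoherent θ ε R r η L δ L' Q : ℝ)) := h Q
    _ ≤ excess Q + C * ((motifChargedGross θ Q : ℝ) - (motifCoreIncoherent θ ε R r η L δ' L'' Q : ℝ)) := by
        nlinarith [mul_le_mul_of_nonneg_left h1 hC]

/-- Dial end `δ < 0`, `L ≤ L'`: CCP holds trivially … -/
theorem coherentCorePricing_of_neg {θ ε R r η L δ L' : ℝ} (hδ : δ < 0) (hL : L ≤ L') : CoherentCorePricing θ ε R r η L δ L' :=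
  ⟨1, one_pos, fun Q => by rw [motifCoreCoherent_eq_zero_of_neg hδ hL, Nat.cast_zero, mul_zero]; exact excess_nonneg' Q⟩

/-- … and NCP is the whole interfacial piece. -/
theorem incoherentCorePricing_iff_interfacial_of_neg {θ ε R r η L δ L' : ℝ} (hδ : δ < 0) (hL : L ≤ L') :
    IncoherentCorePricing θ ε R r η L δ L' ↔ InterfacialCorePricing θ ε R r η L := by
  rw [incoherentCorePricing_iff_speciesPricing, interfacialCorePricing_iff_speciesPricing,
    speciesPricing_congr (c := motifCoreIncoherent θ ε R r η L δ L') (c' := motifCoreInterfacial θ ε R r η L)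
      (fun Q => motifCoreIncoherent_eq_of_neg hδ hL Q)]

/-- Dial end `δ ≥ 5/8`: NCP holds trivially … -/
theorem incoherentCorePricing_of_five_eighths_le {θ ε R r η L δ L' : ℝ} (hδ : 5 / 8 ≤ δ) : IncoherentCorePricing θ ε R r η L δ L' :=
  ⟨1, one_pos, fun Q => by
    rw [motifCoreIncoherent_eq_zero_of_five_eighths_le hδ, Nat.cast_zero, mul_zero]; exact excess_nonneg' Q⟩

/-- … and CCP is the whole interfacial piece: the definition's window on the spacings is load-bearing. -/
theorem coherentCorePricing_iff_interfacial_of_five_eighths_le {θ ε R r η L δ L' : ℝ} (hδ : 5 / 8 ≤ δ) :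
    CoherentCorePricing θ ε R r η L δ L' ↔ InterfacialCorePricing θ ε R r η L := by
  rw [coherentCorePricing_iff_speciesPricing, interfacialCorePricing_iff_speciesPricing,
    speciesPricing_congr (c := motifCoreCoherent θ ε R r η L δ L') (c' := motifCoreInterfacial θ ε R r η L)
      (fun Q => motifCoreCoherent_eq_of_five_eighths_le hδ Q)]

/-! ## §2 Cones by name and the record `(L, δ, L') = (40, 1/10, 40)` -/

/-- `ChargedEnergyGap` from the exposure piece, IP, FCP, CCP, the debited engine target NGP and the P-side. -/
theorem chargedEnergyGap_of_coherenceDial {θ ε R r η L δ L' : ℝ} (hE : ExposedGrossPricing θ ε R) (hI : ImprovablePricing θ ε R r η)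
    (hF : FrustratedCorePricing θ ε R r η L) (hC : CoherentCorePricing θ ε R r η L δ L') (hN : IncoherentGrossDebitPricing θ ε R r η L δ L')
    (hP : ChartedChargePricing θ) : ChargedEnergyGap :=
  chargedEnergyGap_of_deepRigidity hE hI (deepRigidPricing_of_coherenceDial hE hI hF hC hN) hP

/-- ★★ **THE WHOLE GROSS SIDE AT THE RECORD**: `[G] GrossChargeGap (3/20) ⟺ IP ∧ FCP ∧ CCP ∧ NGP` at
`(ε, R, r, η, L, δ, L') = (1/10, 6/5, 10, 1/100, 40, 1/10, 40)`. -/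
theorem grossChargeGap_iff_coherence_record :
    GrossChargeGap (3 / 20) ↔
      ImprovablePricing (3 / 20) (1 / 10) (6 / 5) 10 (1 / 100) ∧
        FrustratedCorePricing (3 / 20) (1 / 10) (6 / 5) 10 (1 / 100) 40 ∧
          CoherentCorePricing (3 / 20) (1 / 10) (6 / 5) 10 (1 / 100) 40 (1 / 10) 40 ∧
            IncoherentGrossDebitPricing (3 / 20) (1 / 10) (6 / 5) 10 (1 / 100) 40 (1 / 10) 40 := by
  constructor
  · intro hG
    have hGC : CompactGrossGap (3 / 20) (1 / 10) (6 / 5) := compactGrossGap_of_grossChargeGap _ _ hG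
    have hD : DeepRigidPricing (3 / 20) (1 / 10) (6 / 5) 10 (1 / 100) := deepRigidPricing_of_compactGrossGap 10 (1 / 100) hGC
    have hICP : InterfacialCorePricing (3 / 20) (1 / 10) (6 / 5) 10 (1 / 100) 40 := interfacialCorePricing_of_deepRigidPricing 40 hD
    exact ⟨improvablePricing_of_compactGrossGap 10 (1 / 100) hGC, frustratedCorePricing_of_deepRigidPricing 40 hD,
      coherentCorePricing_of_interfacialCorePricing (1 / 10) 40 hICP,
      incoherentGrossDebitPricing_of_incoherentCorePricing (incoherentCorePricing_of_interfacialCorePricing (1 / 10) 40 hICP)⟩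
  · rintro ⟨hI, hF, hC, hN⟩
    exact grossChargeGap_iff_improvable_deepRigid_record.2
      ⟨hI, deepRigidPricing_of_coherenceDial exposedGrossPricing_record hI hF hC hN⟩

/-- ★ **RECORD CONE**, five leaves: `ChargedEnergyGap` from IP · FCP(40) · CCP · NGP · P-side at the record. -/
theorem chargedEnergyGap_of_coherenceDial_record (hI : ImprovablePricing (3 / 20) (1 / 10) (6 / 5) 10 (1 / 100))
    (hF : FrustratedCorePricing (3 / 20) (1 / 10) (6 / 5) 10 (1 / 100) 40)
    (hC : CoherentCorePricing (3 / 20) (1 / 10) (6 / 5) 10 (1 / 100) 40 (1 / 10) 40)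
    (hN : IncoherentGrossDebitPricing (3 / 20) (1 / 10) (6 / 5) 10 (1 / 100) 40 (1 / 10) 40)
    (hP : ChartedChargePricing (3 / 20)) : ChargedEnergyGap :=
  chargedEnergyGap_of_pieces (grossChargeGap_iff_coherence_record.2 ⟨hI, hF, hC, hN⟩) hP

/-- The same cone with the debit-free NCP in place of NGP. -/
theorem chargedEnergyGap_of_coherenceDial_recordSplit (hI : ImprovablePricing (3 / 20) (1 / 10) (6 / 5) 10 (1 / 100))
    (hF : FrustratedCorePricing (3 / 20) (1 / 10) (6 / 5) 10 (1 / 100) 40)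
    (hC : CoherentCorePricing (3 / 20) (1 / 10) (6 / 5) 10 (1 / 100) 40 (1 / 10) 40)
    (hN : IncoherentCorePricing (3 / 20) (1 / 10) (6 / 5) 10 (1 / 100) 40 (1 / 10) 40)
    (hP : ChartedChargePricing (3 / 20)) : ChargedEnergyGap :=
  chargedEnergyGap_of_coherenceDial_record hI hF hC (incoherentGrossDebitPricing_of_incoherentCorePricing hN) hP

/-- WEAKER certificates: each coherence piece is implied by the crux (via the compact gap, parts F-B and G). -/
theorem coherentCorePricing_of_chargedEnergyGap (θ ε R r η L δ L' : ℝ) (h : ChargedEnergyGap) :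
    CoherentCorePricing θ ε R r η L δ L' :=
  coherentCorePricing_of_interfacialCorePricing δ L'
    (interfacialCorePricing_of_deepRigidPricing L (deepRigidPricing_of_compactGrossGap r η (compactGrossGap_of_chargedEnergyGap θ ε R h)))

/-- WEAKER: the crux prices the incoherent cores (through interfacial core pricing). -/
theorem incoherentCorePricing_of_chargedEnergyGap (θ ε R r η L δ L' : ℝ) (h : ChargedEnergyGap) :
    IncoherentCorePricing θ ε R r η L δ L' :=
  incoherentCorePricing_of_interfacialCorePricing δ L'
    (interfacialCorePricing_of_deepRigidPricing L (deepRigidPricing_of_compactGrossGap r η (compactGrossGap_of_chargedEnergyGap θ ε R h)))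

/-- WEAKER: the crux implies the engine target NGP (through incoherent core pricing). -/
theorem incoherentGrossDebitPricing_of_chargedEnergyGap (θ ε R r η L δ L' : ℝ) (h : ChargedEnergyGap) :
    IncoherentGrossDebitPricing θ ε R r η L δ L' :=
  incoherentGrossDebitPricing_of_incoherentCorePricing (incoherentCorePricing_of_chargedEnergyGap θ ε R r η L δ L' h)

/-- Bridge to part G's engine shape: NCP and CCP give back IDP (debit-free, hence with any debit). -/
theorem interfacialDebitPricing_of_coherent_incoherent {θ ε R r η L δ L' : ℝ} (hC : CoherentCorePricing θ ε R r η L δ L')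
    (hN : IncoherentCorePricing θ ε R r η L δ L') : InterfacialDebitPricing θ ε R r η L :=
  interfacialDebitPricing_of_interfacialCorePricing ((interfacialCorePricing_iff_coherent_incoherent θ ε R r η L δ L').2 ⟨hC, hN⟩)

end Summit.AtomisticToContinuum.Crystallization.Theorems.ChargedEnergyGapChartDial

end
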